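import Summits.QuantumFields.GaugeBoot.Certificates.SparseReducedWindow
import Summits.QuantumFields.GaugeBoot.Certificates.KZL2rpLIMb2W22UpDA
import Summits.QuantumFields.GaugeBoot.Certificates.KZL2rpLIMb2W22UpDB
import HarnessLib

/-!
# Kernel replay of the certsdp certificate `kzL2rpLIM_D4_b2_W2x2_upper` — part G: factor-row assembly and objective (gb_lean_emit_win 0.11.0-lim)

HONEST FRAMING (cell `pub-gaugeboot`): certified bounds on lattice expectations at stated coupling,
gauge group, dimension and torus size; NOT a mass gap, NOT a continuum limit, NOT a string tension;
NOT Yang–Mills-summit-bearing (barriers `FixedCouplingUltralocality`, `PerturbativeInvisibility`).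

Certificate sha256 `f5d60853e5203e8cbc9910e76e2149f1df1570daed489c717683f822670a518c` (problem `kzL2_D4_b2_max_rp_hkhd_LIM_G2-W2x2-upper`, sha256 `842221231dfca73ac07942ea1c4eef6a78deccc919aa5ad85a1fe636bb401f37`): `GB` = all factor rows (data parts
`Certificates/KZL2rpLIMb2W22UpD….lean` concatenated), the INTEGER objective row `cZ`, the certified bound `lowerQ`, and the kernel check
`gb_len` (factor rows fit the padded dimension 48). Windows: `Certificates/KZL2rpLIMb2W22UpA….lean`; assembly + theorems: `Certificates/KZL2rpLIMb2W22Up.lean`.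
Data/plumbing only; nothing is claimed about lattice gauge theory in this file.
-/

namespace Summit.QuantumFields.GaugeBoot.Certificates.KZL2rpLIMb2W22Up

noncomputable section

open Summit.QuantumFields.GaugeBoot.Certificates.Sparse

/-- All factor rows (concatenation of the data parts' block lists). -/
def GB : List (List (List ℤ)) := GBa ++ GBb

/-- Objective as a sparse INTEGER row: (-1)·y_13. -/
def cZ : List (ℕ × ℤ) := [(13, Int.negSucc 0)]

/-- The certified lower bound on the objective (exact): `-7723555158418186720495793/16320498564797493858533376` (≈ -0.4732425990391). -/
def lowerQ : ℚ := -7723555158418186720495793/16320498564797493858533376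

set_option maxHeartbeats 0 in
/-- Kernel check: every factor row of every block has length `≤ 48`. -/
theorem gb_len : lenCheckAll KZL2rpLIMb2W22Up.GB 48 75 = true := by
  decide +kernel

end

end Summit.QuantumFields.GaugeBoot.Certificates.KZL2rpLIMb2W22Up
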